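import Literature.NumberTheory.GaloisRepresentations.PstWeilDeligneDualDeRham
import Literature.NumberTheory.GaloisRepresentations.FramedRepTwistTraceLocalProofs
import HarnessLib

/-!
# De Rham framed characters: products, inverses, powers; "a de Rham character on inertia"

Topic `NumberTheory/GaloisRepresentations`; namespace `Literature.NumberTheory.GaloisRepresentations`.
Theorems only (no definition, no named fact, no instance).

For a `p`-adic local field `F`, a prime `ℓ` and ANY `𝔇 : PstWeilDeligneData F ℓ`, the rank-one
framed characters `1 ⊗ ε` (`(1 : FramedRep Γ_F ℚ̄_ℓ 1).twist ε`, `ε : Γ_F →ₜ* ℚ̄_ℓˣ`) which are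
de Rham for `𝔇` (`𝔇.IsDeRhamFramed`) form a group: closed under products
(`IsDeRhamFramed.one_twist_mul`, from the accepted `IsDeRhamFramed.twist_det`), inverses
(`one_twist_inv`, from `IsDeRhamFramed.dual` and `FramedRep.dual_twist`), integer powers and finite
products (`one_twist_zpow`, `isDeRhamFramed_one_twist_finset_prod`), containing `1` (unramified).

Main bookkeeping lemma (`isDeRhamFramed_of_inertia_eq_scalar`,
`isDeRhamFramed_of_inertia_eq_finset_prod_zpow`): **a framed representation `ρ` of any rank which on
the inertia group `I_F` (tree `absInertia`) equals the scalar `ε(σ)·1` for a de Rham character `ε` —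
e.g. `ε = ∏_i η_i^{k_i}` with each `1 ⊗ η_i` de Rham — is de Rham**: `ρ = (ρ ⊗ ε⁻¹) ⊗ ε` with
`ρ ⊗ ε⁻¹` unramified (de Rham for every datum, `isDeRhamFramed_of_isLocallyUnramified`).  This is
the local step "locally algebraic ⇒ de Rham once the algebraic part is de Rham" of Serre 1968,
Ch. III §A5 / Conrad 2011, App. B Prop. B.4, in the form needed for the `ℓ`-adic avatar of an
algebraic Hecke character at `v ∣ ℓ`, whose restriction to inertia is `∏_τ (τ̃ ∘ χ_π)^{-n_τ}`
(`χ_π = Art_{K_v}` on inertia: `coe_lubinTateChar_toAbsGalois_canonicalArtin`); it generalises the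
tree's `isDeRhamFramed_toLocal_scalar_comp_of_inertia_eq_cyclotomic_zpow` (the case `ε = χ_cyc^k`).

## References
* [FontaineAsterisque223III] J.-M. Fontaine, Astérisque 223 (1994), Exp. III Prop. 1.5.2
  (`B_dR`-admissible representations are stable under `⊗` and duals).
* [SerreAbelianLadic1968] J.-P. Serre, *Abelian ℓ-adic representations* (1968), Ch. III §A5.
-/

noncomputable section

namespace Literature.NumberTheory.GaloisRepresentations

open Field

variable {F : Type} [Field F] [ValuativeRel F] [TopologicalSpace F] [IsNonarchimedeanLocalField F]
  {ℓ : ℕ} [Fact ℓ.Prime]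

/-- Pointwise inverse of continuous homomorphisms into a commutative group. [folklore] -/
theorem ContinuousMonoidHom.inv_apply' {A E : Type*} [Monoid A] [TopologicalSpace A] [CommGroup E]
    [TopologicalSpace E] [IsTopologicalGroup E] (f : A →ₜ* E) (x : A) : f⁻¹ x = (f x)⁻¹ := rfl

/-- Pointwise integer powers of continuous homomorphisms into a commutative group. [folklore] -/
theorem ContinuousMonoidHom.zpow_apply' {A E : Type*} [Monoid A] [TopologicalSpace A] [CommGroup E]
    [TopologicalSpace E] [IsTopologicalGroup E] (f : A →ₜ* E) (k : ℤ) (x : A) : (f ^ k) x = f x ^ k := by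
  cases k with
  | ofNat n => rw [Int.ofNat_eq_natCast, zpow_natCast, zpow_natCast, ContinuousMonoidHom.pow_apply]
  | negSucc n => rw [zpow_negSucc, zpow_negSucc, ContinuousMonoidHom.inv_apply', ContinuousMonoidHom.pow_apply]

/-- Pointwise finite products of continuous homomorphisms into a commutative group. [folklore] -/
theorem ContinuousMonoidHom.finset_prod_apply' {A E : Type*} [Monoid A] [TopologicalSpace A] [CommGroup E]
    [TopologicalSpace E] [IsTopologicalGroup E] {ι : Type*} (s : Finset ι) (f : ι → (A →ₜ* E)) (x : A) :
    (∏ i ∈ s, f i) x = ∏ i ∈ s, f i x := by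
  classical
  induction s using Finset.induction_on with
  | empty => rw [Finset.prod_empty, Finset.prod_empty, ContinuousMonoidHom.coe_one, Pi.one_apply]
  | insert a s ha ih => rw [Finset.prod_insert ha, Finset.prod_insert ha, ContinuousMonoidHom.mul_apply, ih]

/-- `det` of the trivial rank-`n` framed representation is trivial. [folklore] -/
theorem FramedRep.det_one' {G A : Type*} [Group G] [TopologicalSpace G] [CommRing A] [TopologicalSpace A]
    [IsTopologicalRing A] {n : ℕ} : FramedRep.det (1 : FramedRep G A n) = 1 :=
  ContinuousMonoidHom.ext fun g => by
    simp only [FramedRep.det_apply, ContinuousMonoidHom.coe_one, Pi.one_apply, map_one]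

/-- `det (1 ⊗ ε) = ε` in rank one. [folklore] -/
theorem FramedRep.det_one_twist {G A : Type*} [Group G] [TopologicalSpace G] [CommRing A] [TopologicalSpace A]
    [IsTopologicalRing A] (ε : G →ₜ* Aˣ) :
    FramedRep.det ((1 : FramedRep G A 1).twist ε) = ε := by
  rw [FramedRep.det_twist, pow_one, FramedRep.det_one']
  exact mul_one ε

namespace PstWeilDeligneData

variable {𝔇 : PstWeilDeligneData F ℓ}

/-- **Products of de Rham characters are de Rham** (`(1 ⊗ ε₁) ⊗ det(1 ⊗ ε₂) = 1 ⊗ ε₂ε₁`).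
[cite: FontaineAsterisque223III, Exp. III Prop. 1.5.2] -/
theorem IsDeRhamFramed.one_twist_mul {ε₁ ε₂ : absoluteGaloisGroup F →ₜ* (PadicAlgCl ℓ)ˣ}
    (h₁ : 𝔇.IsDeRhamFramed ((1 : FramedRep (absoluteGaloisGroup F) (PadicAlgCl ℓ) 1).twist ε₁))
    (h₂ : 𝔇.IsDeRhamFramed ((1 : FramedRep (absoluteGaloisGroup F) (PadicAlgCl ℓ) 1).twist ε₂)) :
    𝔇.IsDeRhamFramed ((1 : FramedRep (absoluteGaloisGroup F) (PadicAlgCl ℓ) 1).twist (ε₁ * ε₂)) := by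
  have h := h₁.twist_det h₂
  have hc : ε₁ * ε₂ = ε₂ * ε₁ := ContinuousMonoidHom.ext fun x => by
    rw [ContinuousMonoidHom.mul_apply, ContinuousMonoidHom.mul_apply, mul_comm]
  rw [FramedRep.det_one_twist, FramedRep.twist_twist] at h
  rw [hc]
  exact h

/-- **Inverses (duals) of de Rham characters are de Rham** (`(1 ⊗ ε)^∨ = 1 ⊗ ε⁻¹`).
[cite: FontaineAsterisque223III, Exp. III Prop. 1.5.2] -/
theorem IsDeRhamFramed.one_twist_inv {ε : absoluteGaloisGroup F →ₜ* (PadicAlgCl ℓ)ˣ}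
    (h : 𝔇.IsDeRhamFramed ((1 : FramedRep (absoluteGaloisGroup F) (PadicAlgCl ℓ) 1).twist ε)) :
    𝔇.IsDeRhamFramed ((1 : FramedRep (absoluteGaloisGroup F) (PadicAlgCl ℓ) 1).twist ε⁻¹) := by
  have h' := h.dual
  have h1 : (1 : FramedRep (absoluteGaloisGroup F) (PadicAlgCl ℓ) 1).dual = 1 :=
    ContinuousMonoidHom.ext fun g => Units.ext (by simp)
  rwa [FramedRep.dual_twist, h1] at h'

/-- The trivial character is de Rham (unramified). [folklore] -/
theorem isDeRhamFramed_one_twist_one (𝔇 : PstWeilDeligneData F ℓ) :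
    𝔇.IsDeRhamFramed ((1 : FramedRep (absoluteGaloisGroup F) (PadicAlgCl ℓ) 1).twist 1) := by
  rw [FramedRep.twist_one]
  exact 𝔇.isDeRhamFramed_of_isLocallyUnramified FramedRep.isLocallyUnramified_one

/-- **Integer powers of de Rham characters are de Rham.** [cite: FontaineAsterisque223III, Exp. III Prop. 1.5.2] -/
theorem IsDeRhamFramed.one_twist_zpow {ε : absoluteGaloisGroup F →ₜ* (PadicAlgCl ℓ)ˣ}
    (h : 𝔇.IsDeRhamFramed ((1 : FramedRep (absoluteGaloisGroup F) (PadicAlgCl ℓ) 1).twist ε)) (k : ℤ) :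
    𝔇.IsDeRhamFramed ((1 : FramedRep (absoluteGaloisGroup F) (PadicAlgCl ℓ) 1).twist (ε ^ k)) := by
  induction k using Int.induction_on with
  | zero => rw [zpow_zero]; exact isDeRhamFramed_one_twist_one 𝔇
  | succ n ih => rw [zpow_add_one]; exact ih.one_twist_mul h
  | pred n ih => rw [zpow_sub_one]; exact ih.one_twist_mul h.one_twist_inv

/-- **Finite products of powers of de Rham characters are de Rham.**
[cite: FontaineAsterisque223III, Exp. III Prop. 1.5.2] -/
theorem isDeRhamFramed_one_twist_finset_prod (𝔇 : PstWeilDeligneData F ℓ) {ι : Type*} (s : Finset ι)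
    (ε : ι → (absoluteGaloisGroup F →ₜ* (PadicAlgCl ℓ)ˣ))
    (h : ∀ i ∈ s, 𝔇.IsDeRhamFramed ((1 : FramedRep (absoluteGaloisGroup F) (PadicAlgCl ℓ) 1).twist (ε i))) :
    𝔇.IsDeRhamFramed ((1 : FramedRep (absoluteGaloisGroup F) (PadicAlgCl ℓ) 1).twist (∏ i ∈ s, ε i)) := by
  classical
  induction s using Finset.induction_on with
  | empty => rw [Finset.prod_empty]; exact isDeRhamFramed_one_twist_one 𝔇
  | insert a s ha ih =>
    rw [Finset.prod_insert ha]
    exact (h a (Finset.mem_insert_self a s)).one_twist_mul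
      (ih fun i hi => h i (Finset.mem_insert_of_mem hi))

/-- **A framed representation that is a de Rham character on inertia is de Rham**: if
`ρ(σ) = ε(σ)·1` for all `σ ∈ I_F` and `1 ⊗ ε` is de Rham, then `ρ = (ρ ⊗ ε⁻¹) ⊗ ε` with
`ρ ⊗ ε⁻¹` unramified. This is the local bookkeeping of Serre 1968 III §A5 / Conrad 2011 App. B
Prop. B.4 ("locally algebraic ⇒ de Rham", once the algebraic part `ε` is known to be de Rham).
[cite: SerreAbelianLadic1968, Ch. III §A5] [cite: FontaineAsterisque223III, Exp. III Prop. 1.5.2] -/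
theorem isDeRhamFramed_of_inertia_eq_scalar (𝔇 : PstWeilDeligneData F ℓ) {n : ℕ}
    {ρ : FramedRep (absoluteGaloisGroup F) (PadicAlgCl ℓ) n}
    (ε : absoluteGaloisGroup F →ₜ* (PadicAlgCl ℓ)ˣ)
    (hε : 𝔇.IsDeRhamFramed ((1 : FramedRep (absoluteGaloisGroup F) (PadicAlgCl ℓ) 1).twist ε))
    (hρ : ∀ σ ∈ absInertia F, ρ σ = FramedRep.scalar (PadicAlgCl ℓ) n (ε σ)) :
    𝔇.IsDeRhamFramed ρ := by
  have hunr : (ρ.twist ε⁻¹).IsLocallyUnramified := fun σ hσ => by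
    rw [FramedRep.twist_apply, hρ σ hσ, ContinuousMonoidHom.inv_apply', map_inv, inv_mul_cancel]
  have h := (𝔇.isDeRhamFramed_of_isLocallyUnramified hunr).twist_det hε
  rwa [FramedRep.det_one_twist, FramedRep.twist_twist, mul_inv_cancel, FramedRep.twist_one] at h

/-- The same with the algebraic part given as a finite product of integer powers of de Rham
characters (the shape `∏_τ (τ ∘ χ_π)^{-n_τ}` of an algebraic Hecke character at `v ∣ ℓ`).
[cite: SerreAbelianLadic1968, Ch. III §A5] -/
theorem isDeRhamFramed_of_inertia_eq_finset_prod_zpow (𝔇 : PstWeilDeligneData F ℓ) {n : ℕ}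
    {ρ : FramedRep (absoluteGaloisGroup F) (PadicAlgCl ℓ) n} {ι : Type*} (s : Finset ι)
    (η : ι → (absoluteGaloisGroup F →ₜ* (PadicAlgCl ℓ)ˣ)) (k : ι → ℤ)
    (hη : ∀ i ∈ s, 𝔇.IsDeRhamFramed ((1 : FramedRep (absoluteGaloisGroup F) (PadicAlgCl ℓ) 1).twist (η i)))
    (hρ : ∀ σ ∈ absInertia F, ρ σ = FramedRep.scalar (PadicAlgCl ℓ) n (∏ i ∈ s, η i σ ^ k i)) :
    𝔇.IsDeRhamFramed ρ := by
  refine 𝔇.isDeRhamFramed_of_inertia_eq_scalar (∏ i ∈ s, η i ^ k i)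
    (𝔇.isDeRhamFramed_one_twist_finset_prod s (fun i => η i ^ k i) fun i hi => (hη i hi).one_twist_zpow (k i))
    fun σ hσ => ?_
  rw [hρ σ hσ, ContinuousMonoidHom.finset_prod_apply']
  congr 1
  exact Finset.prod_congr rfl fun i _ => (ContinuousMonoidHom.zpow_apply' _ _ _).symm

end PstWeilDeligneData

end Literature.NumberTheory.GaloisRepresentations

end
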